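import Summits.ValiantsHypothesis.ValiantsHypothesis.Theorems.DivisionGapPerDivisionHardStubTorusCellSplit
import Summits.ValiantsHypothesis.ValiantsHypothesis.Theorems.DivisionGapPerDivisionHardStubTorusFamily

/-!
# Crux `DivisionGap.PerDivisionHard` (stmt-ValiantsHypothesis-5065), line
`pair-descent-jss-endpoint` (v14.2) — stub `stub_productTorus`: the torus normal form WITHIN a
product class

For a product `h = ∏_{i < s} f_i ≠ 0` of cofactors in `ℝ≥0[x_ij]` (`n × n` matrix variables) there
is a family `(f' i)_{i < s}` with `supp (f' i) ⊆ supp (f i)`, every `f' i` TORUS-HOMOGENEOUS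
(`IsTorusHomogeneous`: all monomials share the row-margin vector and the column-margin vector),
the product `∏ f' i` nonzero and torus-homogeneous, and replacing `∏ f i` by `∏ f' i` costs
nothing in either monotone complexity: `L(per_n · ∏ f' i) ≤ L(per_n · ∏ f i)` and
`L(∏ f' i) ≤ L(∏ f i)` (the tree's fan-in-two `complexity` over the semiring `ℝ≥0`).

Proof.  This is `stub_torusFamily` (`Theorems/DivisionGapPerDivisionHardStubTorusFamily.lean`:
the two initial-form steps of `stub_torus` run FACTORWISE with a common radix — top components
are multiplicative over `ℝ≥0`, `topComponent_finset_prod`, and the radix-generalised digit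
uniqueness `mapDomain_eq_of_mem_support_topComponent_radix` makes the margins of every factor
constant) for the family `f` over `Finset.univ : Finset (Fin s)`; every factor of a nonzero
product is nonzero (`Finset.prod_eq_zero`).  Two bookkeeping facts finish: over `ℝ≥0` a product
of nonzero polynomials is nonzero (`support_mul_eq`: the support of a product is the sumset of
the supports, no cancellation), and a product of torus-homogeneous polynomials is
torus-homogeneous (margins are additive: `rowDegrees_add`, `Finsupp.mapDomain_add`, and
`supp (p · q) ⊆ supp p + supp q`). [folklore]
-/

noncomputable section

-- `Summit.ValiantsHypothesis.ValiantsHypothesis.…` is the tree's mandated single-conjunct layout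
-- (Sub = Summit), so the duplicated namespace component is intended.
set_option linter.dupNamespace false

namespace Summit.ValiantsHypothesis.ValiantsHypothesis.Theorems.DivisionGapPerDivisionHard

open MvPolynomial Literature.Computability.AlgebraicComplexity
open Literature.Barriers.ValiantsHypothesis
open Summit.ValiantsHypothesis.ValiantsHypothesis.Theorems.ZeroOneTransfer.Negative
open scoped NNReal Pointwise

variable {n : ℕ}

/-! ### Products over `ℝ≥0`: no zero divisors, torus homogeneity multiplies -/

/-- Over `ℝ≥0` (no cancellation) the product of two nonzero polynomials is nonzero: its support
is the (nonempty) sumset of the supports (`support_mul_eq`). [folklore] -/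
theorem mul_ne_zero_nnreal {σ : Type*} {p q : MvPolynomial σ ℝ≥0} (hp : p ≠ 0) (hq : q ≠ 0) :
    p * q ≠ 0 := by
  classical
  rw [Ne, ← support_eq_empty, JerrumSnir.support_mul_eq, ← Finset.not_nonempty_iff_eq_empty,
    not_not]
  exact (support_nonempty.mpr hp).add (support_nonempty.mpr hq)

/-- Over `ℝ≥0` a finite product of nonzero polynomials is nonzero. [folklore] -/
theorem finset_prod_ne_zero_nnreal {σ ι : Type*} (s : Finset ι) {f : ι → MvPolynomial σ ℝ≥0}
    (hf : ∀ i ∈ s, f i ≠ 0) : ∏ i ∈ s, f i ≠ 0 :=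
  Finset.prod_induction f (fun p => p ≠ 0) (fun _ _ => mul_ne_zero_nnreal) one_ne_zero hf

/-- **Torus homogeneity is multiplicative**: every monomial of `p · q` is a monomial of `p` plus
a monomial of `q` (`support_mul`), and row and column margins are additive. [folklore] -/
theorem IsTorusHomogeneous.mul {p q : MvPolynomial (Fin n × Fin n) ℝ≥0}
    (hp : IsTorusHomogeneous p) (hq : IsTorusHomogeneous q) : IsTorusHomogeneous (p * q) := by
  classical
  obtain ⟨r₁, c₁, h₁⟩ := hp
  obtain ⟨r₂, c₂, h₂⟩ := hq
  refine ⟨r₁ + r₂, c₁ + c₂, fun m hm => ?_⟩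
  obtain ⟨a, ha, b, hb, rfl⟩ := Finset.mem_add.mp (support_mul p q hm)
  obtain ⟨ha₁, ha₂⟩ := h₁ a ha
  obtain ⟨hb₁, hb₂⟩ := h₂ b hb
  exact ⟨by rw [rowDegrees_add, ha₁, hb₁], by rw [Finsupp.mapDomain_add, ha₂, hb₂]⟩

/-- The constant polynomial `1` is torus-homogeneous (its only monomial is `0`). [folklore] -/
theorem isTorusHomogeneous_one : IsTorusHomogeneous (1 : MvPolynomial (Fin n × Fin n) ℝ≥0) := by
  classical
  refine ⟨0, 0, fun m hm => ?_⟩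
  obtain rfl : m = 0 := Finset.mem_singleton.mp (support_monomial_subset hm)
  exact ⟨rowDegrees_zero, Finsupp.mapDomain_zero⟩

/-- A finite product of torus-homogeneous polynomials is torus-homogeneous. [folklore] -/
theorem isTorusHomogeneous_finset_prod {ι : Type*} (s : Finset ι)
    {f : ι → MvPolynomial (Fin n × Fin n) ℝ≥0} (hf : ∀ i ∈ s, IsTorusHomogeneous (f i)) :
    IsTorusHomogeneous (∏ i ∈ s, f i) :=
  Finset.prod_induction f IsTorusHomogeneous (fun _ _ => IsTorusHomogeneous.mul)
    isTorusHomogeneous_one hf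

/-! ### The stub -/

/-- **`stub_productTorus` (v14.2 of line `pair-descent-jss-endpoint` for `PerDivisionHard`).  The
torus normal form WITHIN a product class.**  If `∏_{i < s} f i ≠ 0` in `ℝ≥0[x_ij]`, then there is
a family `f'` with `supp (f' i) ⊆ supp (f i)` and every `f' i` torus-homogeneous, whose product
is nonzero and torus-homogeneous and costs no more in either monotone complexity:
`L(per_n · ∏ f' i) ≤ L(per_n · ∏ f i)` and `L(∏ f' i) ≤ L(∏ f i)`.  Factorwise torus normal form
(`stub_torusFamily` over `Finset.univ`; every factor of the nonzero product is nonzero), then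
`finset_prod_ne_zero_nnreal` and `isTorusHomogeneous_finset_prod`. [folklore] -/
theorem stub_productTorus :
    ∀ (n s : ℕ) (f : Fin s → MvPolynomial (Fin n × Fin n) ℝ≥0), ∏ i, f i ≠ 0 →
      ∃ f' : Fin s → MvPolynomial (Fin n × Fin n) ℝ≥0,
        ∏ i, f' i ≠ 0 ∧ IsTorusHomogeneous (∏ i, f' i) ∧ (∀ i, IsTorusHomogeneous (f' i)) ∧
        (∀ i, (f' i).support ⊆ (f i).support) ∧
        complexity (perPoly (Fin n) ℝ≥0 * ∏ i, f' i) ≤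
          complexity (perPoly (Fin n) ℝ≥0 * ∏ i, f i) ∧
        complexity (∏ i, f' i) ≤ complexity (∏ i, f i) := by
  intro n s f hf
  -- every factor of the nonzero product is nonzero
  have hfi : ∀ i ∈ (Finset.univ : Finset (Fin s)), f i ≠ 0 := fun i hi h0 =>
    hf (Finset.prod_eq_zero hi h0)
  obtain ⟨f', hf', htor, hsub, hle, hle'⟩ := stub_torusFamily n (Fin s) Finset.univ f hfi
  exact ⟨f', finset_prod_ne_zero_nnreal _ hf', isTorusHomogeneous_finset_prod _ htor,
    fun i => htor i (Finset.mem_univ i), fun i => hsub i (Finset.mem_univ i), hle, hle'⟩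

end Summit.ValiantsHypothesis.ValiantsHypothesis.Theorems.DivisionGapPerDivisionHard

end
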